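import Literature.AlgebraicGeometry.Resolution.AdicCompletionRegular
import Literature.AlgebraicGeometry.Resolution.RegularSystemOfParameters
import Literature.AlgebraicGeometry.Resolution.AlterationsNormalFormBlowupChartsFormalProofs
import Mathlib.RingTheory.AdicCompletion.LocalRing
import HarnessLib

/-!
# A regular local ring with a coefficient field, read through a cofinal tower of `𝔪`-primary
# ideals, is a compatible tower of quotients of `k⟦X₁, …, X_g⟧`

Topic `Literature/RingTheory/RegularLocalRing`, namespace `Literature.RingTheory.RegularLocalRing`.
Everything is PROVED; no definitions, no named facts.

Setting: `(R, 𝔪)` a regular local ring of dimension `g` together with a *coefficient map*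
`ι : k →+* R` from a field onto the residue field (every `r ∈ R` is `ι a` modulo `𝔪` — e.g. the
local ring of a smooth `g`-dimensional `k`-scheme at a `k`-rational point), and a tower of ideals
`I 0 ⊇ I 1 ⊇ I 2 ⊇ ⋯` of `R` which are `𝔪`-primary (`𝔪^N ⊆ I n` for some `N = N(n)`) and cofinal
with the powers of `𝔪` (`I n ⊆ 𝔪^N` for some `n = n(N)`).

* §1 `factor_evalₐ_eq_factor_evalₐ` — bookkeeping for Mathlib's `AdicCompletion.evalₐ`: the
  projection `Â → R ⧸ J` through any `𝔪^M ⊆ J` does not depend on `M`.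
* §2 **`exists_ringHom_mvPowerSeries_quotient_tower`** — there are ring maps
  `ψ n : k⟦X₁, …, X_g⟧ → R ⧸ I n`, compatible with the transition maps `R ⧸ I m → R ⧸ I n`
  (`n ≤ m`), SURJECTIVE, with NILPOTENT values on the variables, inducing `ι` on constants, and
  JOINTLY INJECTIVE (`⋂ₙ ker (ψ n) = 0`). Proof: the completion `Â` is a complete regular local
  ring of dimension `g` (Matsumura, proof of Thm. 19.5; `isRegularLocalRing_adicCompletion`) with
  `𝔪Â` generated by a regular system of parameters `x₁, …, x_g` of `R` and the same residue field,
  so Cohen's structure theorem in the sharp form «`Â = k⟦x₁, …, x_g⟧`» (Matsumura Thm. 29.7,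
  `exists_ringEquiv_mvPowerSeries_of_generators`) gives `e : Â ≃ k⟦X⟧` with `e xᵢ = Xᵢ`,
  `e ∘ ι = C`; then `ψ n := (Â → R ⧸ 𝔪^{N(n)} → R ⧸ I n) ∘ e⁻¹`. Surjectivity is that of
  `Â → R ⧸ 𝔪^N`; joint injectivity is cofinality plus the separatedness of `Â`.

This is the commutative-algebra core of the special-fibre input of Tate's algebraization argument
for the unit components of the torsion of an abelian scheme ([Tate1967] §2.2, proof of Prop. 1:
the `k`-step), with `R = 𝒪_{Y_k,e}` and `I n` the ideal of the unit component of `Y_k[pⁿ]`; the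
geometric reading is not formalised here.

## References

* [Matsumura1987] H. Matsumura, *Commutative Ring Theory*, CUP 1986: §8 (completion, Thm. 8.4,
  (8.6)–(8.7) `Â/𝔪ⁿÂ = A/𝔪ⁿ`), §19 p. 158 (proof of Thm. 19.5: the completion of a regular local
  ring is regular), Thm. 29.7 (Cohen: equicharacteristic complete regular local rings are power
  series rings).
* [Tate1967] J. Tate, *p-divisible groups*, Proc. Conf. Local Fields (Driebergen 1966), Springer
  1967, §2.2.
-/

noncomputable section

namespace Literature.RingTheory.RegularLocalRing

universe u

open IsLocalRing

/-! ## §1 Projections of the adic completion onto `R ⧸ J`, `𝔪^M ⊆ J` -/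

section EvalFactor

variable {R : Type u} [CommRing R] (I : Ideal R)

/-- For `M₁ ≤ M₂` and `I^{M₁} ⊆ J`, `I^{M₂} ⊆ J`, the two projections `R̂ → R⧸I^{Mᵢ} → R⧸J` of the
`I`-adic completion agree (Matsumura (8.6)–(8.7): the completion is the inverse limit of the
`R⧸Iⁿ` with its transition maps). [cite: Matsumura1987, §8 (8.6)–(8.7)] -/
theorem factor_evalₐ_eq_factor_evalₐ_of_le {M₁ M₂ : ℕ} (hM : M₁ ≤ M₂) {J : Ideal R}
    (h₁ : I ^ M₁ ≤ J) (h₂ : I ^ M₂ ≤ J) (x : AdicCompletion I R) :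
    Ideal.Quotient.factor h₁ (AdicCompletion.evalₐ I M₁ x) =
      Ideal.Quotient.factor h₂ (AdicCompletion.evalₐ I M₂ x) := by
  obtain ⟨f, rfl⟩ := AdicCompletion.mk_surjective I R x
  rw [AdicCompletion.evalₐ_mk, AdicCompletion.evalₐ_mk, Ideal.Quotient.factor_mk,
    Ideal.Quotient.factor_mk, Ideal.Quotient.mk_eq_mk_iff_sub_mem]
  have hf : f.val M₁ ≡ f.val M₂ [SMOD (I ^ M₁ • ⊤ : Submodule R R)] := f.property hM
  rw [SModEq.sub_mem, smul_eq_mul, Ideal.mul_top] at hf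
  exact h₁ hf

/-- The projection `R̂ → R⧸I^M → R⧸J` of the `I`-adic completion through any exponent `M` with
`I^M ⊆ J` is independent of `M`. [cite: Matsumura1987, §8 (8.6)–(8.7)] -/
theorem factor_evalₐ_eq_factor_evalₐ {M₁ M₂ : ℕ} {J : Ideal R} (h₁ : I ^ M₁ ≤ J)
    (h₂ : I ^ M₂ ≤ J) (x : AdicCompletion I R) :
    Ideal.Quotient.factor h₁ (AdicCompletion.evalₐ I M₁ x) =
      Ideal.Quotient.factor h₂ (AdicCompletion.evalₐ I M₂ x) := by
  rcases le_total M₁ M₂ with hM | hM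
  · exact factor_evalₐ_eq_factor_evalₐ_of_le I hM h₁ h₂ x
  · exact (factor_evalₐ_eq_factor_evalₐ_of_le I hM h₂ h₁ x).symm

/-- An element of the `I`-adic completion all of whose projections to the quotients `R ⧸ J n` of a
tower COFINAL with the powers of `I` (`J n ⊆ I^N` for some `n = n(N)`) vanish is zero: the
completion is `I`-adically separated. [cite: Matsumura1987, §8 Thm. 8.2] -/
theorem eq_zero_of_forall_factor_evalₐ_eq_zero (J : ℕ → Ideal R) {N : ℕ → ℕ}
    (hN : ∀ n, I ^ N n ≤ J n) (hcof : ∀ M, ∃ n, J n ≤ I ^ M) (x : AdicCompletion I R)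
    (hx : ∀ n, Ideal.Quotient.factor (hN n) (AdicCompletion.evalₐ I (N n) x) = 0) : x = 0 := by
  refine AdicCompletion.ext_evalₐ fun M => ?_
  obtain ⟨n, hn⟩ := hcof M
  rw [map_zero]
  have h := congrArg (Ideal.Quotient.factor hn) (hx n)
  rw [map_zero, Ideal.Quotient.factor_comp_apply,
    factor_evalₐ_eq_factor_evalₐ I ((hN n).trans hn) (le_refl (I ^ M)) x,
    Ideal.Quotient.factor_eq] at h
  exact h

end EvalFactor

/-! ## §2 The tower of quotients of a regular local ring with a coefficient field -/

section Tower

variable {k : Type u} [Field k] {R : Type u} [CommRing R] [IsRegularLocalRing R]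

/-- **A regular local ring with a coefficient field is, through any cofinal tower of `𝔪`-primary
ideals, a compatible tower of quotients of `k⟦X₁, …, X_g⟧`.** Let `(R, 𝔪)` be regular local of
dimension `g`, `ι : k → R` a ring map from a field with `R = ι(k) + 𝔪`, and `I n` (`n ≥ 0`) a
decreasing sequence of ideals with `𝔪^{N(n)} ⊆ I n` and, for every `N`, `I n ⊆ 𝔪^N` for some `n`.
Then there are ring maps `ψ n : k⟦X₁, …, X_g⟧ → R ⧸ I n` which are compatible with the
transition maps, restrict to `ι` on the constants, are surjective, take nilpotent values on the
variables, and have `⋂ₙ ker ψ n = 0`. (Cohen's structure theorem `R̂ ≅ k⟦X₁, …, X_g⟧` for the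
completion — regular of the same dimension with the same residue field — composed with the
projections `R̂ → R ⧸ 𝔪^N → R ⧸ I n`.)
[cite: Matsumura1987, Thm. 29.7 with §19 p. 158 (proof of Thm. 19.5) and §8 (8.6)–(8.7)] -/
theorem exists_ringHom_mvPowerSeries_quotient_tower (ι : k →+* R)
    (hι : ∀ r : R, ∃ a : k, r - ι a ∈ maximalIdeal R) {g : ℕ} (hdim : ringKrullDim R = g)
    (I : ℕ → Ideal R) (hI : Antitone I) (hprim : ∀ n, ∃ N, maximalIdeal R ^ N ≤ I n)
    (hcof : ∀ N, ∃ n, I n ≤ maximalIdeal R ^ N) :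
    ∃ ψ : ∀ n, MvPowerSeries (Fin g) k →+* R ⧸ I n,
      (∀ ⦃n m : ℕ⦄ (h : n ≤ m) (G : MvPowerSeries (Fin g) k),
          Ideal.Quotient.factor (hI h) (ψ m G) = ψ n G) ∧
      (∀ n (a : k), ψ n (MvPowerSeries.C a) = Ideal.Quotient.mk (I n) (ι a)) ∧
      (∀ n, Function.Surjective (ψ n)) ∧
      (∀ n (s : Fin g), IsNilpotent (ψ n (MvPowerSeries.X s))) ∧
      ⨅ n, RingHom.ker (ψ n) = ⊥ := by
  classical
  -- exponents `N n` with `𝔪 ^ N n ≤ I n`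
  choose N hN using hprim
  -- the completion `C = R̂`: Noetherian, local, complete, regular of dimension `g`
  let C := AdicCompletion (maximalIdeal R) R
  haveI : IsNoetherianRing C :=
    Literature.AlgebraicGeometry.Resolution.isNoetherianRing_adicCompletion_maximalIdeal R
  have hdimC : ringKrullDim C = g := by
    have h := Literature.AlgebraicGeometry.Resolution.ringKrullDim_adicCompletion R
    rw [hdim] at h
    exact h
  -- a regular system of parameters of `R`, re-indexed by `Fin g`, mapped to `C`
  have hg : (maximalIdeal R).spanFinrank = g := by
    have h := IsRegularLocalRing.spanFinrank_maximalIdeal (R := R)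
    rw [hdim] at h
    exact_mod_cast h
  obtain ⟨y, hy⟩ := Literature.AlgebraicGeometry.Resolution.exists_regularSystemOfParameters (R := R)
  have hym : ∀ j, y j ∈ maximalIdeal R := fun j => hy ▸ Ideal.subset_span ⟨j, rfl⟩
  -- the structure map `R → C` followed by the projection `C → R ⧸ 𝔪ⁿ` is the quotient map
  have hev : ∀ n (r : R), AdicCompletion.evalₐ (maximalIdeal R) n (algebraMap R C r) =
      Ideal.Quotient.mk (maximalIdeal R ^ n) r := fun n r => by
    rw [AdicCompletion.algebraMap_apply, AdicCompletion.evalₐ_of, Algebra.algebraMap_self_apply]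
  let x : Fin g → C := fun i => algebraMap R C (y (Fin.cast hg.symm i))
  have hxrange : Set.range x = algebraMap R C '' Set.range y := by
    ext c
    simp only [Set.mem_range, Set.mem_image, x]
    constructor
    · rintro ⟨i, rfl⟩
      exact ⟨y (Fin.cast hg.symm i), ⟨_, rfl⟩, rfl⟩
    · rintro ⟨_, ⟨j, rfl⟩, rfl⟩
      exact ⟨Fin.cast hg j, by simp⟩
  have hx : Ideal.span (Set.range x) = maximalIdeal C := by
    rw [hxrange, ← Ideal.map_span, hy, AdicCompletion.maximalIdeal_eq_map]
  -- the coefficient map of `C`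
  let ι' : k →+* C := (algebraMap R C).comp ι
  have hι' : ∀ c : C, ∃ l : k, c - ι' l ∈ maximalIdeal C := by
    intro c
    obtain ⟨r, hr⟩ := Ideal.Quotient.mk_surjective (AdicCompletion.evalₐ (maximalIdeal R) 1 c)
    obtain ⟨a, ha⟩ := hι r
    refine ⟨a, ?_⟩
    have h1 : c - algebraMap R C r ∈ maximalIdeal C := by
      rw [AdicCompletion.mem_maximalIdeal_iff_eval_one_eq_zero]
      have h2 : AdicCompletion.evalₐ (maximalIdeal R) 1 (c - algebraMap R C r) = 0 := by
        rw [map_sub, hev, hr, sub_self]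
      have h3 := congrArg (Ideal.Quotient.factor (le_of_eq (Ideal.mul_top _).symm :
        maximalIdeal R ^ 1 ≤ maximalIdeal R ^ 1 • ⊤)) h2
      rwa [map_zero, AdicCompletion.factor_evalₐ_eq_eval, AdicCompletion.eval_apply] at h3
    have h2 : algebraMap R C r - ι' a ∈ maximalIdeal C := by
      rw [AdicCompletion.maximalIdeal_eq_map]
      have : algebraMap R C r - ι' a = algebraMap R C (r - ι a) := by
        simp [ι', map_sub]
      rw [this]
      exact Ideal.mem_map_of_mem _ ha
    have : c - ι' a = (c - algebraMap R C r) + (algebraMap R C r - ι' a) := by ring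
    rw [this]
    exact Ideal.add_mem _ h1 h2
  -- Cohen: `C ≃ k⟦X₁, …, X_g⟧`
  obtain ⟨e, heX, heC⟩ :=
    Literature.AlgebraicGeometry.Resolution.exists_ringEquiv_mvPowerSeries_of_generators
      ι' hι' x hx hdimC
  -- the projections `π n : C → R ⧸ I n`
  let π : ∀ n, C →+* R ⧸ I n := fun n =>
    (Ideal.Quotient.factor (hN n)).comp (AdicCompletion.evalₐ (maximalIdeal R) (N n)).toRingHom
  have hπ : ∀ n (c : C), π n c =
      Ideal.Quotient.factor (hN n) (AdicCompletion.evalₐ (maximalIdeal R) (N n) c) :=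
    fun n c => rfl
  have hπ_of : ∀ n (r : R), π n (algebraMap R C r) = Ideal.Quotient.mk (I n) r := by
    intro n r
    rw [hπ, hev, Ideal.Quotient.factor_mk]
  let ψ : ∀ n, MvPowerSeries (Fin g) k →+* R ⧸ I n := fun n => (π n).comp e.symm.toRingHom
  have hψ : ∀ n f, ψ n f = π n (e.symm f) := fun n f => rfl
  refine ⟨ψ, ?_, ?_, ?_, ?_, ?_⟩
  · -- compatibility with the transition maps
    intro n m h f
    rw [hψ, hψ, hπ, hπ, Ideal.Quotient.factor_comp_apply]
    exact factor_evalₐ_eq_factor_evalₐ (maximalIdeal R) _ _ _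
  · -- constants
    intro n a
    have hca : e.symm (MvPowerSeries.C a) = ι' a := by
      rw [← heC a, RingEquiv.symm_apply_apply]
    rw [hψ, hca]
    change π n (algebraMap R C (ι a)) = _
    rw [hπ_of]
  · -- surjectivity
    intro n b
    obtain ⟨c, hc⟩ := ((Ideal.Quotient.factor_surjective (hN n)).comp
      (AdicCompletion.surjective_evalₐ (maximalIdeal R) (N n))) b
    refine ⟨e c, ?_⟩
    rw [hψ, RingEquiv.symm_apply_apply, hπ]
    exact hc
  · -- nilpotent values on the variables
    intro n s
    have hxs : e.symm (MvPowerSeries.X s) = x s := by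
      rw [← heX s, RingEquiv.symm_apply_apply]
    refine ⟨N n, ?_⟩
    rw [hψ, hxs]
    change π n (algebraMap R C (y (Fin.cast hg.symm s))) ^ N n = 0
    rw [hπ_of, ← map_pow, Ideal.Quotient.eq_zero_iff_mem]
    exact hN n (Ideal.pow_mem_pow (hym _) _)
  · -- joint injectivity
    rw [eq_bot_iff]
    intro f hf
    rw [Ideal.mem_bot]
    have hf' : ∀ n, ψ n f = 0 := fun n => (RingHom.mem_ker).mp ((Ideal.mem_iInf.mp hf) n)
    have hc : e.symm f = 0 := by
      refine eq_zero_of_forall_factor_evalₐ_eq_zero (maximalIdeal R) I hN hcof (e.symm f) ?_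
      intro n
      rw [← hπ, ← hψ]
      exact hf' n
    simpa using congrArg e hc

end Tower

end Literature.RingTheory.RegularLocalRing

end
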